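import Mathlib.LinearAlgebra.Dual.Lemmas
import Mathlib.LinearAlgebra.FiniteDimensional.Lemmas
import HarnessLib

/-!
# The substitution method for bilinear computations (Bläser 2003, §2; Alder–Strassen 1981)

Topic `Literature/Computability/AlgebraicComplexity`. First of the proof files behind
`SmallFormatRank.lean` (target: `blaser2003_thm14`, Bläser 2003, Theorem 14:
`R(⟨n,m,n⟩) ≥ 2mn + 2n − m − 2` for `m ≥ n ≥ 3`). This file is the abstract part of the
lower-bound technique, for an arbitrary bilinear map `φ : U × V → W` over a field:

* `BilinComp φ ι` — a **bilinear computation** of `φ` indexed by a finite type `ι`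
  (Bläser 2003, Def. 1): linear forms `f_i ∈ U*`, `g_i ∈ V*` and vectors `w_i ∈ W` with
  `φ(u, v) = ∑_i f_i(u) g_i(v) w_i`.
* `BilinComp.Separates β U₁ V₁ W₁` — `β` **separates** the triple `(U₁, V₁, W₁)` (Bläser 2003,
  Def. 2): there are disjoint index sets `I, J ⊆ {i | w_i ∉ W₁}` with
  `U₁ ∩ ⋂_{i ∈ I} ker f_i = 0` and `V₁ ∩ ⋂_{j ∈ J} ker g_j = 0`.
* `BilinComp.Separates.finrank_add_finrank_add_card_le` — **Lemma 3**: if `β` separates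
  `(U₁, V₁, W₁)` then `|ι| ≥ dim U₁ + dim V₁ + #{i | w_i ∈ W₁}` (stated for every finite set `N` of
  indices `i` with `w_i ∈ W₁`).
* `BilinComp.Separates.extension_left` / `extension_right` — **Lemma 4**, the Extension Lemma of
  Alder and Strassen in the bilinear form of Bläser 2003 (p. 47): if `β` separates `(U₁, V₁, W₁)`
  and `U₁ ⊆ U₂`, then `β` separates `(U₂, V₁, W₁)` or there is `u ∈ U₂ ∖ U₁` with
  `φ(u, V) ⊆ φ(u, V₁) + W₁`; and symmetrically in the second argument.

## Proof of the Extension Lemma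

(Bläser 2003 refers to Bläser 2000 [5] for the bilinear case; the argument is the standard one.)
Shrink `J` to `J' ⊆ J` such that `v ↦ (g_j(v))_{j ∈ J'}` is a bijection `V₁ → k^{J'}`
(`exists_subset_forall_exists_eq`: a spanning family of `V₁*` contains a basis). Let
`N' = {i | w_i ∉ W₁} ∖ J'`. Either the `f_i`, `i ∈ N'`, have no common zero on `U₂ ∖ 0` — then
`(N', J')` separates `(U₂, V₁, W₁)` — or some `u ∈ U₂ ∖ 0` has `f_i(u) = 0` for all `i ∈ N'`;
then `u ∉ U₁` (as `I ⊆ N'`), and for `v ∈ V` pick `v₁ ∈ V₁` with `g_j(v₁) = g_j(v)` (`j ∈ J'`):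
every term of `φ(u, v − v₁) = ∑ f_i(u) g_i(v − v₁) w_i` lies in `W₁`.

## References

* M. Bläser, *On the complexity of the multiplication of matrices of small formats*,
  J. Complexity 19 (2003) 43–60, §2 (Def. 1, Def. 2, Lemma 3, Lemma 4). [Blaser2003]
* A. Alder, V. Strassen, *On the algorithmic complexity of associative algebras*,
  Theoret. Comput. Sci. 15 (1981) 201–211 (the original Extension Lemma).
* P. Bürgisser, M. Clausen, M. A. Shokrollahi, *Algebraic Complexity Theory* (1997), Ch. 17.
-/

namespace Literature.Computability.AlgebraicComplexity

open Module

variable {k : Type*} [Field k]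
variable {U V W : Type*} [AddCommGroup U] [Module k U] [AddCommGroup V] [Module k V]
  [AddCommGroup W] [Module k W]

/-- A **bilinear computation** of the bilinear map `φ : U × V → W`, indexed by the finite type `ι`
(Bläser 2003, Def. 1): triples `(f_i, g_i, w_i)` with `f_i ∈ U*`, `g_i ∈ V*`, `w_i ∈ W` such that
`φ(u, v) = ∑_i f_i(u) g_i(v) w_i` for all `u, v`. Its length is `|ι|`. [cite: Blaser2003, Def. 1] -/
structure BilinComp (φ : U →ₗ[k] V →ₗ[k] W) (ι : Type*) [Fintype ι] where
  /-- the linear forms on the first argument -/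
  f : ι → Module.Dual k U
  /-- the linear forms on the second argument -/
  g : ι → Module.Dual k V
  /-- the output vectors -/
  w : ι → W
  /-- the computation computes `φ` -/
  map_eq_sum : ∀ u v, φ u v = ∑ i, (f i u * g i v) • w i

namespace BilinComp

variable {φ : U →ₗ[k] V →ₗ[k] W} {ι : Type*} [Fintype ι]

/-- Exchanging the roles of the two arguments: a computation of `φ` is a computation of
`φ.flip : V × U → W`. [cite: Blaser2003, §3] -/
def flip (β : BilinComp φ ι) : BilinComp φ.flip ι where
  f := β.g
  g := β.f
  w := β.w
  map_eq_sum v u := by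
    rw [LinearMap.flip_apply, β.map_eq_sum]
    simp [mul_comm]

/-- The first forms of the flipped computation. [cite: Blaser2003, §3] -/
@[simp] theorem flip_f (β : BilinComp φ ι) : β.flip.f = β.g := rfl

/-- The second forms of the flipped computation. [cite: Blaser2003, §3] -/
@[simp] theorem flip_g (β : BilinComp φ ι) : β.flip.g = β.f := rfl

/-- The output vectors of the flipped computation. [cite: Blaser2003, §3] -/
@[simp] theorem flip_w (β : BilinComp φ ι) : β.flip.w = β.w := rfl

/-- `β` **separates** the triple `(U₁, V₁, W₁)` (Bläser 2003, Def. 2): there are disjoint sets of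
indices `I, J ⊆ {i | w_i ∉ W₁}` such that `U₁ ∩ ⋂_{i∈I} ker f_i = 0` and
`V₁ ∩ ⋂_{j∈J} ker g_j = 0`. [cite: Blaser2003, Def. 2] -/
def Separates (β : BilinComp φ ι) (U₁ : Submodule k U) (V₁ : Submodule k V)
    (W₁ : Submodule k W) : Prop :=
  ∃ I J : Finset ι, Disjoint I J ∧ (∀ i ∈ I, β.w i ∉ W₁) ∧ (∀ j ∈ J, β.w j ∉ W₁) ∧
    (∀ u ∈ U₁, (∀ i ∈ I, β.f i u = 0) → u = 0) ∧ (∀ v ∈ V₁, (∀ j ∈ J, β.g j v = 0) → v = 0)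

/-- Separation is symmetric under `flip`. [cite: Blaser2003, Def. 2] -/
theorem Separates.flip {β : BilinComp φ ι} {U₁ : Submodule k U} {V₁ : Submodule k V}
    {W₁ : Submodule k W} (h : β.Separates U₁ V₁ W₁) : β.flip.Separates V₁ U₁ W₁ := by
  obtain ⟨I, J, hIJ, hI, hJ, hU, hV⟩ := h
  exact ⟨J, I, hIJ.symm, hJ, hI, hV, hU⟩

/-- Separation is symmetric under `flip`. [cite: Blaser2003, Def. 2] -/
theorem Separates.of_flip {β : BilinComp φ ι} {U₁ : Submodule k U} {V₁ : Submodule k V}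
    {W₁ : Submodule k W} (h : β.flip.Separates V₁ U₁ W₁) : β.Separates U₁ V₁ W₁ := by
  obtain ⟨I, J, hIJ, hI, hJ, hU, hV⟩ := h
  exact ⟨J, I, hIJ.symm, hJ, hI, hV, hU⟩

/-- Every computation separates `(0, 0, W₁)` (Bläser 2003, proof of Lemma 5, step 1).
[cite: Blaser2003, Lemma 5 (step 1)] -/
theorem separates_bot_bot (β : BilinComp φ ι) (W₁ : Submodule k W) : β.Separates ⊥ ⊥ W₁ :=
  ⟨∅, ∅, disjoint_bot_left, by simp, by simp, fun u hu _ => (Submodule.mem_bot k).1 hu,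
    fun v hv _ => (Submodule.mem_bot k).1 hv⟩

/-- Separation is monotone (downwards) in the first two subspaces. [cite: Blaser2003, Def. 2] -/
theorem Separates.mono {β : BilinComp φ ι} {U₁ U₂ : Submodule k U} {V₁ V₂ : Submodule k V}
    {W₁ : Submodule k W} (h : β.Separates U₂ V₂ W₁) (hU : U₁ ≤ U₂) (hV : V₁ ≤ V₂) :
    β.Separates U₁ V₁ W₁ := by
  obtain ⟨I, J, hIJ, hI, hJ, hU', hV'⟩ := h
  exact ⟨I, J, hIJ, hI, hJ, fun u hu h0 => hU' u (hU hu) h0, fun v hv h0 => hV' v (hV hv) h0⟩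

/-- The linear forms indexed by `I` have no common zero on `U₁ ∖ 0` iff `u ↦ (f_i u)_{i∈I}` is
injective on `U₁`; hence `dim U₁ ≤ |I|`. [folklore] -/
theorem finrank_le_card_of_forall_eq_zero [FiniteDimensional k U] (U₁ : Submodule k U)
    (I : Finset ι) (f : ι → Module.Dual k U)
    (hU : ∀ u ∈ U₁, (∀ i ∈ I, f i u = 0) → u = 0) : finrank k U₁ ≤ I.card := by
  let ψ : U₁ →ₗ[k] (I → k) := LinearMap.pi fun i => (f i).comp U₁.subtype
  have hψ : Function.Injective ψ := by
    rw [← LinearMap.ker_eq_bot, LinearMap.ker_eq_bot']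
    intro u hu
    have h0 : (u : U) = 0 :=
      hU u u.2 fun i hi => by simpa [ψ] using congrFun hu ⟨i, hi⟩
    exact Subtype.ext h0
  calc finrank k U₁ ≤ finrank k (I → k) := LinearMap.finrank_le_finrank_of_injective hψ
    _ = I.card := by simp

/-- **Bläser 2003, Lemma 3.** If `β` separates `(U₁, V₁, W₁)`, then the length of `β` is at least
`dim U₁ + dim V₁ + #{i | w_i ∈ W₁}`; here for any finite set `N` of indices with `w_i ∈ W₁`.
[cite: Blaser2003, Lemma 3] -/
theorem Separates.finrank_add_finrank_add_card_le [FiniteDimensional k U]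
    [FiniteDimensional k V] {β : BilinComp φ ι} {U₁ : Submodule k U} {V₁ : Submodule k V}
    {W₁ : Submodule k W} (h : β.Separates U₁ V₁ W₁) (N : Finset ι) (hN : ∀ i ∈ N, β.w i ∈ W₁) :
    finrank k U₁ + finrank k V₁ + N.card ≤ Fintype.card ι := by
  classical
  obtain ⟨I, J, hIJ, hI, hJ, hU, hV⟩ := h
  have h1 : finrank k U₁ ≤ I.card := finrank_le_card_of_forall_eq_zero U₁ I β.f hU
  have h2 : finrank k V₁ ≤ J.card := finrank_le_card_of_forall_eq_zero V₁ J β.g hV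
  have hIN : Disjoint I N := Finset.disjoint_left.2 fun i hi hiN => hI i hi (hN i hiN)
  have hJN : Disjoint J N := Finset.disjoint_left.2 fun j hj hjN => hJ j hj (hN j hjN)
  have h3 : I.card + J.card + N.card = (I ∪ J ∪ N).card := by
    rw [Finset.card_union_of_disjoint (Finset.disjoint_union_left.2 ⟨hIN, hJN⟩),
      Finset.card_union_of_disjoint hIJ]
  calc finrank k U₁ + finrank k V₁ + N.card ≤ I.card + J.card + N.card := by omega
    _ = (I ∪ J ∪ N).card := h3
    _ ≤ Fintype.card ι := Finset.card_le_univ _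

/-- A finite family of linear forms without common zero on `V₁ ∖ 0` contains a subfamily `J'` for
which `v ↦ (g_j v)_{j ∈ J'}` is a bijection `V₁ → k^{J'}` (a spanning family of `V₁*` contains a
basis). [folklore] -/
theorem exists_subset_forall_exists_eq [FiniteDimensional k V] (V₁ : Submodule k V)
    (J : Finset ι) (g : ι → Module.Dual k V) (hJ : ∀ v ∈ V₁, (∀ j ∈ J, g j v = 0) → v = 0) :
    ∃ J' : Finset ι, J' ⊆ J ∧ (∀ v ∈ V₁, (∀ j ∈ J', g j v = 0) → v = 0) ∧
      ∀ c : ι → k, ∃ v ∈ V₁, ∀ j ∈ J', g j v = c j := by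
  classical
  -- the family of restricted forms
  let γ : ι → Module.Dual k V₁ := fun j => (g j).comp V₁.subtype
  obtain ⟨b, hbJ, -, hspan, hli⟩ :=
    exists_linearIndepOn_extension (linearIndepOn_empty k γ) (Set.empty_subset (J : Set ι))
  have hbfin : b.Finite := J.finite_toSet.subset hbJ
  refine ⟨hbfin.toFinset, fun j hj => hbJ (hbfin.mem_toFinset.1 hj), ?_, ?_⟩
  · -- no common zero: the forms `γ j`, `j ∈ J`, lie in the span of the `γ j`, `j ∈ b`
    intro v hv h0
    refine hJ v hv fun j hj => ?_
    have hmem : γ j ∈ Submodule.span k (γ '' b) := hspan ⟨j, hj, rfl⟩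
    have hker : ∀ ψ ∈ Submodule.span k (γ '' b), ψ ⟨v, hv⟩ = 0 := by
      intro ψ hψ
      refine Submodule.span_induction ?_ ?_ ?_ ?_ hψ
      · rintro _ ⟨j', hj', rfl⟩
        exact h0 j' (hbfin.mem_toFinset.2 hj')
      · simp
      · intro x y _ _ hx hy
        simp [hx, hy]
      · intro c x _ hx
        simp [hx]
    simpa [γ] using hker (γ j) hmem
  · -- bijectivity by counting dimensions
    intro c
    set J' := hbfin.toFinset with hJ'
    have hinj : ∀ v ∈ V₁, (∀ j ∈ J', g j v = 0) → v = 0 := by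
      intro v hv h0
      refine hJ v hv fun j hj => ?_
      have hmem : γ j ∈ Submodule.span k (γ '' b) := hspan ⟨j, hj, rfl⟩
      have hker : ∀ ψ ∈ Submodule.span k (γ '' b), ψ ⟨v, hv⟩ = 0 := by
        intro ψ hψ
        refine Submodule.span_induction ?_ ?_ ?_ ?_ hψ
        · rintro _ ⟨j', hj', rfl⟩
          exact h0 j' (hbfin.mem_toFinset.2 hj')
        · simp
        · intro x y _ _ hx hy
          simp [hx, hy]
        · intro c x _ hx
          simp [hx]
      simpa [γ] using hker (γ j) hmem
    let T : V₁ →ₗ[k] (J' → k) := LinearMap.pi fun j => γ j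
    have hTinj : Function.Injective T := by
      rw [← LinearMap.ker_eq_bot, LinearMap.ker_eq_bot']
      intro v hv
      have h0 : (v : V) = 0 :=
        hinj v v.2 fun j hj => by simpa [T, γ] using congrFun hv ⟨j, hj⟩
      exact Subtype.ext h0
    have hle : finrank k V₁ ≤ J'.card := finrank_le_card_of_forall_eq_zero V₁ J' g hinj
    have hge : J'.card ≤ finrank k V₁ := by
      have hli' : LinearIndependent k (fun j : J' => γ j) := by
        have e : (J' : Set ι) = b := by simp [hJ']
        have h1 : LinearIndepOn k γ (J' : Set ι) := by rw [e]; exact hli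
        exact h1
      have := hli'.fintype_card_le_finrank
      rw [Subspace.dual_finrank_eq] at this
      simpa using this
    have hdim : finrank k V₁ = finrank k (J' → k) := by
      rw [Module.finrank_fintype_fun_eq_card, Fintype.card_coe]; omega
    have hTsurj : Function.Surjective T :=
      (LinearMap.injective_iff_surjective_of_finrank_eq_finrank hdim).1 hTinj
    obtain ⟨v, hv⟩ := hTsurj fun j => c j
    refine ⟨v, v.2, fun j hj => ?_⟩
    simpa [T, γ] using congrFun hv ⟨j, hj⟩

/-- **Bläser 2003, Lemma 4 (Extension Lemma of Alder–Strassen), first argument.** If `β`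
separates `(U₁, V₁, W₁)` (and, in print, `U₁ ⊆ U₂` — not needed), then `β` separates
`(U₂, V₁, W₁)` too, or there is some `u ∈ U₂ ∖ U₁` with `φ(u, V) ⊆ φ(u, V₁) + W₁`.
[cite: Blaser2003, Lemma 4] -/
theorem Separates.extension_left [FiniteDimensional k V] {β : BilinComp φ ι}
    {U₁ U₂ : Submodule k U} {V₁ : Submodule k V} {W₁ : Submodule k W}
    (h : β.Separates U₁ V₁ W₁) :
    β.Separates U₂ V₁ W₁ ∨
      ∃ u ∈ U₂, u ∉ U₁ ∧ ∀ v : V, ∃ v₁ ∈ V₁, φ u v - φ u v₁ ∈ W₁ := by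
  classical
  obtain ⟨I, J, hIJ, hI, hJ, hU, hV⟩ := h
  obtain ⟨J', hJ'J, hV', hsurj⟩ := exists_subset_forall_exists_eq V₁ J β.g hV
  set N' : Finset ι := (Finset.univ.filter fun i => β.w i ∉ W₁) \ J' with hN'
  by_cases hsep : ∀ u ∈ U₂, (∀ i ∈ N', β.f i u = 0) → u = 0
  · left
    refine ⟨N', J', Finset.sdiff_disjoint, fun i hi => ?_, fun j hj => hJ j (hJ'J hj), hsep, hV'⟩
    exact (Finset.mem_filter.1 (Finset.mem_sdiff.1 hi).1).2
  · right
    push Not at hsep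
    obtain ⟨u, hu2, hf0, hu0⟩ := hsep
    refine ⟨u, hu2, fun hu1 => hu0 (hU u hu1 fun i hi => hf0 i ?_), fun v => ?_⟩
    · -- `I ⊆ N'`
      refine Finset.mem_sdiff.2 ⟨Finset.mem_filter.2 ⟨Finset.mem_univ _, hI i hi⟩, fun hiJ' => ?_⟩
      exact Finset.disjoint_left.1 hIJ hi (hJ'J hiJ')
    · obtain ⟨v₁, hv₁, hg⟩ := hsurj fun j => β.g j v
      refine ⟨v₁, hv₁, ?_⟩
      have hexp : φ u v - φ u v₁ = ∑ i, (β.f i u * β.g i (v - v₁)) • β.w i := by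
        rw [← map_sub, β.map_eq_sum]
      rw [hexp]
      refine Submodule.sum_mem _ fun i _ => ?_
      by_cases hw : β.w i ∈ W₁
      · exact Submodule.smul_mem _ _ hw
      · by_cases hiJ' : i ∈ J'
        · have : β.g i (v - v₁) = 0 := by rw [map_sub, hg i hiJ', sub_self]
          simp [this]
        · have hiN' : i ∈ N' :=
            Finset.mem_sdiff.2 ⟨Finset.mem_filter.2 ⟨Finset.mem_univ _, hw⟩, hiJ'⟩
          simp [hf0 i hiN']

/-- **Bläser 2003, Lemma 4 (Extension Lemma), second argument** ("holds in the same manner for a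
subspace `V₂` with `V₁ ⊆ V₂ ⊆ V`"; the inclusion is not needed): if `β` separates `(U₁, V₁, W₁)`,
then `β` separates `(U₁, V₂, W₁)`, or some `v ∈ V₂ ∖ V₁` has `φ(U, v) ⊆ φ(U₁, v) + W₁`.
[cite: Blaser2003, Lemma 4] -/
theorem Separates.extension_right [FiniteDimensional k U] {β : BilinComp φ ι}
    {U₁ : Submodule k U} {V₁ V₂ : Submodule k V} {W₁ : Submodule k W}
    (h : β.Separates U₁ V₁ W₁) :
    β.Separates U₁ V₂ W₁ ∨
      ∃ v ∈ V₂, v ∉ V₁ ∧ ∀ u : U, ∃ u₁ ∈ U₁, φ u v - φ u₁ v ∈ W₁ := by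
  rcases h.flip.extension_left (U₂ := V₂) with h' | ⟨v, hv2, hv1, hv⟩
  · exact Or.inl h'.of_flip
  · exact Or.inr ⟨v, hv2, hv1, fun u => by simpa using hv u⟩

end BilinComp

end Literature.Computability.AlgebraicComplexity
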